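import Summits.QuantumFields.BalabanUV.Beta.SymRootedKernelReflection
import Summits.QuantumFields.BalabanUV.Beta.DshAn1
import Summits.QuantumFields.BalabanUV.Beta.E3ContactGenerator
import Summits.QuantumFields.BalabanUV.Beta.VhPieceReflection

/-!
# `BalabanUV.Beta.SymVhSliceReflectionAn1` — binder row D1, TABLES-SYM-LEAN step S2e #2 (hR, FIRST ORDER): **(V-r) OF THE ROOTS OF RECORD** —
# the three border letters `hVfm`, `hVmf`, `hVmm` of an1's first-order symmetrised table `symVhSAt ρ_c` against the SYMMETRISED bordered Hessian
# `bhK Lc + Dsh Lc`, contact `(Lc^{d+1})⁻¹ • diagK (ctGenM d (bhK Lc + Dsh Lc) α Lc κ′ u)`, VERBATIM, plus `hHr` restated: the four hR first-order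
# binders of `RowD1JointEndSymReflTablesAn1S2(M).d1Drift_JsB12Sym_an1TablesS2_of_…` (ROOT F p288196 :121–:133 = ROOT G p293447 :121–:133) are theorems

HONEST FRAMING (cell charter, verbatim): «discharging `BetaPertH` makes Bałaban's UV stability UNCONDITIONAL — a real constructive-QFT
result; it is NOT the continuum limit and NOT the Clay problem.»  DERIVED cell leaf (pub-balaban β sub-cell, row BETA, lane an1, gen 43):
[folklore] entrywise algebra — sym twin of an2's `Beta.VhSliceReflectionScaled` §1–§2 / `Beta.DiagonalContact.conjV_bhKAt_ctGen_*` with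
`bhKAt ρ_c ↦ bhK + Dsh` (an1 g40's `Beta.DshAn1` §2: the border of `bhK + Dsh` IS `±((d+1)!)⁻¹ symLinAvgAt ρ_c`), `ctGen ↦ ctGenM (bhK + Dsh)` (e3's
`Beta.E3ContactGenerator`), `ctE ↦ symCtE`, `vhSAt_bref ↦ symVhSAt_bref` (S2e #1).  No statement of Bałaban's papers is typed here, no `[cite:]`
tag, no `Prop` fact, no `BetaPertH`; NOT continuum; NOT Clay.  Nothing printed is asserted.

WHAT IS PROVED (`N ≥ 1`, centred root `ctr (d+1) N`, `q¹_sym = symLinKerAt`):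
* §1 the border of `bhK N + Dsh N` in KERNEL currency: `inv_factorial_mul_symLinAvgAt_delta1` (`((d+1)!)⁻¹ symLinAvgAt ρ_c δ_{(β,y)} = N^{d+1} q¹_sym(β,y)`),
  **`symB_inl_inr`** `= −[proj z = 0] N^{d+1} q¹_sym(β,x)_{(m, z∕N)}`, **`symB_inr_inl`** `= [proj x = 0] N^{d+1} q¹_sym(β,z)_{(m, x∕N)}`, `symB_inr_inr = 0`;
* §2 THE IDENTITY on the three border blocks: **`conjV_symB_ctGenM_inl_inr/_inr_inl`** `conjV (bhK+Dsh) (diagK (ctGenM d (bhK+Dsh) α N κ′ u)) =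
  −N^{d+1} · packVH (symCtE α N) N κ′ u` entrywise on `(inl, inr)`, `(inr, inl)`; `conjV_symB_diagK_inr_inr = 0`;
* §3 (dimension `n + 1`, `L` odd, `[NeZero L]`) the letters **`symVhSAt_bref_inl_inr/_inr_inl/_inr_inr`**:
  `symVhSAt ρ_c κ′ (bref α κ′ u) ab = (ε_{κ′} • refK (Φ L α) (symVhSAt ρ_c κ′ u + conjV (bhK L + Dsh L) ((L^{n+1})⁻¹ • diagK (ctGenM n (bhK L + Dsh L) α L κ′ u)))) ab`
  for the leg pairs `ab ∈ {(inl β, inr m), (inr m, inl β), (inr m, inr m′)}` and ALL `x z` (the field–field pair is NOT claimed: there the product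
  chart carries the Wilson contact, cf. an2's `conjV_bhKAt_ctGen_inl_inl`; the roots of record do not ask for it at first order);
* §4 AT THE ROOT OF RECORD (`n + 1 = 4`, `ctr 4 Lc`, `Lc` odd): **`hVfm_sym`**, **`hVmf_sym`**, **`hVmm_sym`**, **`hHr_sym'`** — the binders `hVfm`
  `hVmf` `hVmm` `hHr` of `RowD1JointEndSymReflTablesAn1S2.d1Drift_JsB12Sym_an1TablesS2_of_bordMixLetters_reflTableLetters_D1Tel_D1Rep` (ROOT F, :121–:133) = of
  `RowD1JointEndSymReflTablesAn1S2M.d1Drift_JsB12Sym_an1TablesS2_of_bordMixWard_bordReflLetters_D1Tel_D1Rep` (ROOT G, :121–:133) with their statements VERBATIM (instantiation; `3 + 1 = 4` by `rfl`).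

USE: an2's next root (ROOT H of the S2 series, over ROOT G p293447) may delete the four hR first-order binders by `hVfm_sym hLc`, `hVmf_sym hLc`, `hVmm_sym hLc`,
`hHr_sym' hLc` (or S2e #1's `hHr_sym hLc`).  Remaining displayed table letters after S2d + S2e: none of first order; see GAPS § C-an1-134.

Provenance: b2b-balaban β sub-cell, row BETA, lane an1 (W-supplier «AN1»), gen 43, 2026-08-21 (TABLES-SYM-LEAN S2e); over S2e #1, an1 g40's `Beta.DshAn1`
(`bhK_add_Dsh_inl_inr/_inr_inl`), e3's `Beta.E3ContactGenerator` (`ctGenM_inl/_inr`), an2's `Beta.DiagonalContact` (`conjV_diagK_apply`, `off_eq_zero_iff_proj`,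
`blk_eq_quo`) and `Beta.VhPieceReflection` (`conjV_smul_right`) BY NAME — nothing of theirs re-typed.  Bib keys (locators only): Balaban1985Averaging, Balaban1987RG1.

VERSION v1 (2026-08-21, b2b-balaban-beta-an1-g43): new leaf (theorems only; `--kind proof`).
-/

open Finset
open scoped BigOperators Nat
open Literature.Probability.LatticeModels (Torus.proj)
open Literature.MathematicalPhysics.QuantumFieldTheory
open Literature.MathematicalPhysics.QuantumFieldTheory.Balaban1983to89
open Literature.MathematicalPhysics.QuantumFieldTheory.Balaban1983to89.Beta
open ExpKernelCalculus (MKer)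
open AveragingContours (blk off)
open AveragingContoursRooted (ctr)
open AveragingHessianKernels (Bond packVH packVH_inl_inr packVH_inr_inl packVH_inl_inl packVH_inr_inr)
open KKTFluctuationKernel (delta1)
open LatticeForm (quo)
open OneStepResolventKernel (Fib)
open PolarizationSign (reflSign)
open KernelReflection (refK refK_apply)
open ResolventReflection (bref Φ Φ_r_inl Φ_r_inr Φ_s_inl Φ_s_inr)
open Summit.QuantumFields.BalabanUV.Beta.ChartConjugation (conjV)
open Summit.QuantumFields.BalabanUV.Beta.BorderedHessian (bhK bhK_inr_inr diagK conjV_diagK_apply off_eq_zero_iff_proj blk_eq_quo)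
open Summit.QuantumFields.BalabanUV.Beta.SpineRooted (conjV_smul_right)
open Summit.QuantumFields.BalabanUV.Beta.DshAn1 (Dsh Dsh_inr_inr bhK_add_Dsh_inl_inr bhK_add_Dsh_inr_inl)
open Summit.QuantumFields.BalabanUV.Beta.E3ContactGenerator (ctGenM ctGenM_inl ctGenM_inr)
open Summit.QuantumFields.BalabanUV.Beta.SymmetrisedAxialPotential (symLinAvgAt)
open Summit.QuantumFields.BalabanUV.Beta.SymAveragingHessianCounts
open Summit.QuantumFields.BalabanUV.Beta.SymRootedKernelReflection (symCtE symVhSAt_bref symHessFFAt_reflect)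

noncomputable section

namespace Summit.QuantumFields.BalabanUV.Beta.SymVhSliceReflectionAn1

variable {d : ℕ}

/-! ## §1 The symmetrised rooted border `bhK + Dsh` in KERNEL currency: `±L^{d+1} · q¹_sym` (an1 g40's `DshAn1` §2 + gen 41's bridge) -/

/-- [folklore] `((d+1)!)⁻¹ · symLinAvgAt ρ_c (δ_{(β,y)}) N m Y = N^{d+1} · q¹_sym(β, y)_{(m, Y)}` (gen 41's `symLinKerAt_eq_symLinAvgAt`; `delta1` by `rfl`). -/
theorem inv_factorial_mul_symLinAvgAt_delta1 {N : ℕ} [NeZero N] (β : Fin (d + 1)) (y : Fin (d + 1) → ℤ) (m : Fin (d + 1))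
    (Y : Fin (d + 1) → ℤ) :
    ((d + 1) ! : ℝ)⁻¹ * symLinAvgAt (ctr (d + 1) N) (delta1 β y) N m Y
      = (N : ℝ) ^ (d + 1) * symLinKerAt (ctr (d + 1) N) N m Y (β, y) := by
  have hN : ((N : ℝ) ^ (d + 1)) ≠ 0 := pow_ne_zero _ (by exact_mod_cast NeZero.ne N)
  rw [symLinKerAt_eq_symLinAvgAt, ← mul_assoc, mul_inv_cancel₀ hN, one_mul]
  rfl

/-- [folklore] **FIELD–MULTIPLIER BORDER OF `bhK + Dsh`, kernel currency**: `= −[proj N z = 0] · N^{d+1} · q¹_sym(β, x)_{(m, z∕N)}`. -/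
theorem symB_inl_inr {N : ℕ} [NeZero N] (x z : Fin (d + 1) → ℤ) (β m : Fin (d + 1)) :
    (bhK N + Dsh N : MKer (d + 1) (Fib d)) x z (Sum.inl β) (Sum.inr m)
      = if Torus.proj N z = 0 then -((N : ℝ) ^ (d + 1) * symLinKerAt (ctr (d + 1) N) N m (quo N z) (β, x)) else 0 := by
  rw [bhK_add_Dsh_inl_inr, inv_factorial_mul_symLinAvgAt_delta1]

/-- [folklore] **MULTIPLIER–FIELD BORDER OF `bhK + Dsh`, kernel currency**: `= [proj N x = 0] · N^{d+1} · q¹_sym(β, z)_{(m, x∕N)}`. -/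
theorem symB_inr_inl {N : ℕ} [NeZero N] (x z : Fin (d + 1) → ℤ) (m β : Fin (d + 1)) :
    (bhK N + Dsh N : MKer (d + 1) (Fib d)) x z (Sum.inr m) (Sum.inl β)
      = if Torus.proj N x = 0 then (N : ℝ) ^ (d + 1) * symLinKerAt (ctr (d + 1) N) N m (quo N x) (β, z) else 0 := by
  rw [bhK_add_Dsh_inr_inl, inv_factorial_mul_symLinAvgAt_delta1]

/-- [folklore] The multiplier–multiplier block of `bhK + Dsh` vanishes. -/
theorem symB_inr_inr {N : ℕ} (x z : Fin (d + 1) → ℤ) (m m' : Fin (d + 1)) :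
    (bhK N + Dsh N : MKer (d + 1) (Fib d)) x z (Sum.inr m) (Sum.inr m') = 0 := by
  rw [Pi.add_apply, Pi.add_apply, Pi.add_apply, Pi.add_apply, bhK_inr_inr, Dsh_inr_inr, add_zero]

/-! ## §2 THE IDENTITY: `conjV (bhK + Dsh) (diagK (ctGenM d (bhK + Dsh) α L κ′ u)) = −L^{d+1} · packVH E^sym_α` on the three border blocks
(sym twin of an2's `conjV_bhKAt_ctGen_inl_inr/inr_inl/inr_inr`, with e3's border-reading generator `ctGenM`) -/

/-- [folklore] **FIELD–MULTIPLIER BLOCK of the identity.** -/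
theorem conjV_symB_ctGenM_inl_inr {N : ℕ} [NeZero N] (α κ' : Fin (d + 1)) (u x z : Fin (d + 1) → ℤ) (β μ : Fin (d + 1)) :
    conjV (bhK N + Dsh N) (diagK (ctGenM d (bhK N + Dsh N) α N κ' u)) x z (Sum.inl β) (Sum.inr μ)
      = -((N : ℝ) ^ (d + 1)) * packVH (symCtE α N) N κ' u x z (Sum.inl β) (Sum.inr μ) := by
  classical
  have hN : ((N : ℝ) ^ (d + 1)) ≠ 0 := pow_ne_zero _ (by exact_mod_cast NeZero.ne N)
  rw [conjV_diagK_apply, symB_inl_inr, packVH_inl_inr, ctGenM_inl, ctGenM_inr, symB_inr_inl]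
  by_cases hz : off N z = 0
  · have hz' : Torus.proj N z = 0 := (off_eq_zero_iff_proj z).1 hz
    simp only [hz', hz, if_true, ← blk_eq_quo, symCtE]
    have e : (x = u ∧ β = κ' ∧ κ' = α) ↔ ((β, x) = (κ', u) ∧ β = α) :=
      ⟨fun h => ⟨by rw [h.1, h.2.1], h.2.1.trans h.2.2⟩, fun h => ⟨(Prod.mk.inj h.1).2, (Prod.mk.inj h.1).1,
        (Prod.mk.inj h.1).1.symm.trans h.2⟩⟩
    simp only [e]
    split_ifs <;> field_simp <;> ring
  · have hz' : ¬ Torus.proj N z = 0 := fun h => hz ((off_eq_zero_iff_proj z).2 h)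
    rw [if_neg hz', if_neg hz, zero_mul, mul_zero]

/-- [folklore] **MULTIPLIER–FIELD BLOCK of the identity.** -/
theorem conjV_symB_ctGenM_inr_inl {N : ℕ} [NeZero N] (α κ' : Fin (d + 1)) (u x z : Fin (d + 1) → ℤ) (μ β : Fin (d + 1)) :
    conjV (bhK N + Dsh N) (diagK (ctGenM d (bhK N + Dsh N) α N κ' u)) x z (Sum.inr μ) (Sum.inl β)
      = -((N : ℝ) ^ (d + 1)) * packVH (symCtE α N) N κ' u x z (Sum.inr μ) (Sum.inl β) := by
  classical
  have hN : ((N : ℝ) ^ (d + 1)) ≠ 0 := pow_ne_zero _ (by exact_mod_cast NeZero.ne N)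
  rw [conjV_diagK_apply, symB_inr_inl, packVH_inr_inl, ctGenM_inl, ctGenM_inr, symB_inr_inl]
  by_cases hx : off N x = 0
  · have hx' : Torus.proj N x = 0 := (off_eq_zero_iff_proj x).1 hx
    simp only [hx', hx, if_true, ← blk_eq_quo, symCtE]
    have e : (z = u ∧ β = κ' ∧ κ' = α) ↔ ((β, z) = (κ', u) ∧ β = α) :=
      ⟨fun h => ⟨by rw [h.1, h.2.1], h.2.1.trans h.2.2⟩, fun h => ⟨(Prod.mk.inj h.1).2, (Prod.mk.inj h.1).1,
        (Prod.mk.inj h.1).1.symm.trans h.2⟩⟩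
    simp only [e]
    split_ifs <;> field_simp <;> ring
  · have hx' : ¬ Torus.proj N x = 0 := fun h => hx ((off_eq_zero_iff_proj x).2 h)
    rw [if_neg hx', if_neg hx, zero_mul, mul_zero]

/-- [folklore] **MULTIPLIER–MULTIPLIER BLOCK**: the contact vanishes there (and so does `packVH`). -/
theorem conjV_symB_diagK_inr_inr {N : ℕ} (g : (Fin (d + 1) → ℤ) → Fib d → ℝ) (x z : Fin (d + 1) → ℤ) (μ μ' : Fin (d + 1)) :
    conjV (bhK N + Dsh N) (diagK g) x z (Sum.inr μ) (Sum.inr μ') = 0 := by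
  rw [conjV_diagK_apply, symB_inr_inr, zero_mul]

/-! ## §3 THE THREE (V-r) BORDER LETTERS at every dimension `n + 1` (centred root, `L` odd): `symVhSAt_bref` (S2e #1 §8) + §2 -/

section Letters

variable {n : ℕ} {L : ℕ} [NeZero L] (hL : Odd L)
include hL

/-- [folklore] **(V-r), FIELD–MULTIPLIER LEG PAIR** — the binder `hVfm` of the roots of record at `n + 1 = 4`:
`symVhSAt ρ_c κ′ (bref α κ′ u) (x, inl β; z, inr m) = (ε_{κ′} • refK (Φ L α) (symVhSAt ρ_c κ′ u + conjV (bhK L + Dsh L) ((L^{n+1})⁻¹ • diagK (ctGenM n (bhK L + Dsh L) α L κ′ u)))) (x, inl β; z, inr m)`. -/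
theorem symVhSAt_bref_inl_inr (α κ' : Fin (n + 1)) (u x z : Fin (n + 1) → ℤ) (β m : Fin (n + 1)) :
    symVhSAt (ctr (n + 1) L) n L rfl κ' (bref α κ' u) x z (Sum.inl β) (Sum.inr m)
      = (reflSign α κ' • refK (Φ L α) (symVhSAt (ctr (n + 1) L) n L rfl κ' u
          + conjV (bhK L + Dsh L) ((((L : ℝ) ^ (n + 1))⁻¹) • diagK (ctGenM n (bhK L + Dsh L) α L κ' u))))
            x z (Sum.inl β) (Sum.inr m) := by
  have hN : ((L : ℝ) ^ (n + 1)) ≠ 0 := pow_ne_zero _ (by exact_mod_cast NeZero.ne L)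
  rw [symVhSAt_bref hL]
  simp only [Pi.smul_apply, Pi.add_apply, Pi.sub_apply, smul_eq_mul, refK_apply, conjV_smul_right, Φ_r_inl, Φ_r_inr,
    conjV_symB_ctGenM_inl_inr]
  field_simp
  ring

/-- [folklore] **(V-r), MULTIPLIER–FIELD LEG PAIR** — the binder `hVmf`. -/
theorem symVhSAt_bref_inr_inl (α κ' : Fin (n + 1)) (u x z : Fin (n + 1) → ℤ) (m β : Fin (n + 1)) :
    symVhSAt (ctr (n + 1) L) n L rfl κ' (bref α κ' u) x z (Sum.inr m) (Sum.inl β)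
      = (reflSign α κ' • refK (Φ L α) (symVhSAt (ctr (n + 1) L) n L rfl κ' u
          + conjV (bhK L + Dsh L) ((((L : ℝ) ^ (n + 1))⁻¹) • diagK (ctGenM n (bhK L + Dsh L) α L κ' u))))
            x z (Sum.inr m) (Sum.inl β) := by
  have hN : ((L : ℝ) ^ (n + 1)) ≠ 0 := pow_ne_zero _ (by exact_mod_cast NeZero.ne L)
  rw [symVhSAt_bref hL]
  simp only [Pi.smul_apply, Pi.add_apply, Pi.sub_apply, smul_eq_mul, refK_apply, conjV_smul_right, Φ_r_inl, Φ_r_inr,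
    conjV_symB_ctGenM_inr_inl]
  field_simp
  ring

omit [NeZero L] in
/-- [folklore] **(V-r), MULTIPLIER–MULTIPLIER LEG PAIR** — the binder `hVmm` (both sides vanish). -/
theorem symVhSAt_bref_inr_inr (α κ' : Fin (n + 1)) (u x z : Fin (n + 1) → ℤ) (m m' : Fin (n + 1)) :
    symVhSAt (ctr (n + 1) L) n L rfl κ' (bref α κ' u) x z (Sum.inr m) (Sum.inr m')
      = (reflSign α κ' • refK (Φ L α) (symVhSAt (ctr (n + 1) L) n L rfl κ' u
          + conjV (bhK L + Dsh L) ((((L : ℝ) ^ (n + 1))⁻¹) • diagK (ctGenM n (bhK L + Dsh L) α L κ' u))))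
            x z (Sum.inr m) (Sum.inr m') := by
  rw [symVhSAt_bref hL]
  simp only [Pi.smul_apply, Pi.add_apply, Pi.sub_apply, smul_eq_mul, refK_apply, conjV_smul_right, Φ_r_inr,
    conjV_symB_diagK_inr_inr, symVhSAt, packVH_inr_inr, mul_zero, sub_zero, add_zero]

end Letters

/-! ## §4 AT THE ROOT OF RECORD (`n + 1 = 4`, `ctr 4 Lc`, `Lc` odd): the four hR first-order binders of
`RowD1JointEndSymReflTablesAn1S2(M).d1Drift_JsB12Sym_an1TablesS2_of_…`, VERBATIM -/

section Record

variable {Lc : ℕ} [NeZero Lc] (hLc : Odd Lc)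
include hLc

/-- [folklore] **`hVfm` IS A THEOREM.** -/
theorem hVfm_sym : ∀ (α κ' : Fin 4) (u x z : Fin 4 → ℤ) (β m : Fin 4),
    symVhSAt (ctr 4 Lc) 3 Lc rfl κ' (bref α κ' u) x z (Sum.inl β) (Sum.inr m)
      = (reflSign α κ' • refK (Φ (d := 3) Lc α) (symVhSAt (ctr 4 Lc) 3 Lc rfl κ' u
          + conjV (bhK (d := 3) Lc + Dsh Lc) ((((Lc : ℝ) ^ 4)⁻¹) • diagK (ctGenM 3 (bhK Lc + Dsh Lc) α Lc κ' u))))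
            x z (Sum.inl β) (Sum.inr m) :=
  fun α κ' u x z β m => symVhSAt_bref_inl_inr hLc α κ' u x z β m

/-- [folklore] **`hVmf` IS A THEOREM.** -/
theorem hVmf_sym : ∀ (α κ' : Fin 4) (u x z : Fin 4 → ℤ) (m β : Fin 4),
    symVhSAt (ctr 4 Lc) 3 Lc rfl κ' (bref α κ' u) x z (Sum.inr m) (Sum.inl β)
      = (reflSign α κ' • refK (Φ (d := 3) Lc α) (symVhSAt (ctr 4 Lc) 3 Lc rfl κ' u
          + conjV (bhK (d := 3) Lc + Dsh Lc) ((((Lc : ℝ) ^ 4)⁻¹) • diagK (ctGenM 3 (bhK Lc + Dsh Lc) α Lc κ' u))))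
            x z (Sum.inr m) (Sum.inl β) :=
  fun α κ' u x z m β => symVhSAt_bref_inr_inl hLc α κ' u x z m β

omit [NeZero Lc] in
/-- [folklore] **`hVmm` IS A THEOREM.** -/
theorem hVmm_sym : ∀ (α κ' : Fin 4) (u x z : Fin 4 → ℤ) (m m' : Fin 4),
    symVhSAt (ctr 4 Lc) 3 Lc rfl κ' (bref α κ' u) x z (Sum.inr m) (Sum.inr m')
      = (reflSign α κ' • refK (Φ (d := 3) Lc α) (symVhSAt (ctr 4 Lc) 3 Lc rfl κ' u
          + conjV (bhK (d := 3) Lc + Dsh Lc) ((((Lc : ℝ) ^ 4)⁻¹) • diagK (ctGenM 3 (bhK Lc + Dsh Lc) α Lc κ' u))))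
            x z (Sum.inr m) (Sum.inr m') :=
  fun α κ' u x z m m' => symVhSAt_bref_inr_inr hLc α κ' u x z m m'

omit [NeZero Lc] in
/-- [folklore] **`hHr` IS A THEOREM** (S2e #1's `symHessFFAt_reflect` at `n + 1 = 4`, `N = Lc`; restated here so the four hR first-order
letters of the roots of record sit in one module). -/
theorem hHr_sym' : ∀ (α μ : Fin 4) (y : Fin 4 → ℤ),
    symHessFFAt (ctr 4 Lc) Lc μ (bref α μ y) = reflSign α μ • refK (Φ (d := 3) Lc α) (symHessFFAt (ctr 4 Lc) Lc μ y) :=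
  fun α μ y => symHessFFAt_reflect hLc Lc α μ y

end Record

end Summit.QuantumFields.BalabanUV.Beta.SymVhSliceReflectionAn1
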